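import Literature.IUT.HodgeArakelov.BadPrimeGaussianMonoidsGenuineRecordOrbitOfOrbitLift
import Literature.IUT.HodgeArakelov.BadPrimeGaussianMonoidsGenuineRecordSplittingPair
import Literature.IUT.HodgeArakelov.ThetaEvaluationSettingAtModelTate
import HarnessLib

/-!
# [IUTchII] Cor 3.5 (ii) / Prop 3.1 (i) junction inputs AT THE [EtTh] STAGE-2 MODEL `modelχq p i j` (Tate instance
# `modelTate p = modelχq p 1 2`): `horbit` / `horb` / `hroots` and the Prop 3.1 (i) «splittings up to torsion» closer with
# EVERY ι-datum binder, EVERY class-level [EtTh] Prop 1.4 clause and `hker` DISCHARGED (proof-only; D-0079 K-L6)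

S. Mochizuki, *Inter-universal Teichmüller theory II*, kurims manuscript (Dec. 2020), Prop. 2.2 (ii) p. 66, Cor. 2.8 (i) p. 82,
Prop. 3.1 (i) p. 87 («splittings up to torsion»), Cor. 3.5 (ii) p. 95 [claim: Mochizuki2012, status: disputed] (IUTchII §3 Prop 3.1
(i), kurims p.87); S. Mochizuki, *The étale theta function …* [EtTh], Publ. RIMS **45** (2009) (refereed): Prop. 1.4 (ii) PRIMS
PDF p. 22, Prop. 1.5 (ii), (iii) p. 23, Thm. 1.6 (i)–(iii) p. 24, Def. 2.5 (i) p. 39, Def. 2.7 p. 41, Cor. 2.19 (ii) p. 64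
[cite: MochizukiEtTh2009, Thm 1.6 (iii) p.24].

Cell `abc-iut`, seat abc-iut-w5-d072 (gen 4; (R1) ι-datum custody lineage), D-0079 programme L-K, K-L6 slice, row
«COR35ii-PROP31i-IOTA-DATUM-AT-MODELTATE» (CLAIM 17:4xZ; abc-iut-L6-lead §F v1.19bd (1): the «r» rows Prop2.2(ii) / Prop3.1(i)
hinge on GAP row D-G-w4d010-2f; abc-iut-w4-d010 g11 17:17:35Z: «same entry points for your modelTate instance on the Cor3.5(ii)
side»). Sequel of this seat's `ThetaEvaluationSettingAtModelTate` (p457878/p458562: the same discharge for IUTchII:Prop2.2(ii)).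
PROOF-ONLY companion: NO definition, NO instance, NO new named fact; every input consumed BY NAME — abc-iut-w4-d010's orbit-form
closers `EtaleLevels.horbit_thetaEnvData_/horb_toRecord_/hroots_toRecord_inversion_of_classLevel_orbit` and
`EtaleThetaDataOfSetting.rootLevel_inputs_of_classLevel_orbit` (p457998, over abc-iut-w4-d004's row «COR35ii-HORB-GENUINE»
files 1–5), abc-iut-w4-d004's Prop 3.1 (i) closer of record `EtaleLevels.splitting_toRecord_padic_of_eval_pairRhoLim` (p441594),
abc-iut-w4-d041's `hfix_of_cyclotomeTower` + `hker_coh_of_fixed`, and layer L2's stage-2 theorems (abc-iut-L2-d1 / w5-d249 / L2-t5 /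
L2-t8 / f-149); nothing landed is edited or restated.

WHAT IS PROVED, at `D := ThetaSetting.modelχq p i j hj` (every `i`, even `j`), for EVERY étale-theta datum `E` carrying the class
of record (`E.etaDd = etaDdχq`), every `ι`-stable `X̲̲`-choice `C` (`hι`), the inversion `ι := inversionχq` with its CONSTRUCTED
theta companion `thetaCompanionOfAut` (abc-iut-w5-d072; `IsInversionAut.map_deltaTemp`, `hasThetaTopology_modelχq`), and the genuine
`θ_env` data `EtaleLevels.thetaEnvData C …` over ARBITRARY record inputs (`mods`, `f`, `h15`, `L`, `hZ`, `hcharY`, `hlim`):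
* `horbit_thetaEnvData_modelχq` — the raw [IUTchII] Prop 2.2 (ii) `μ_{2l}`-orbit clause in the limit;
* `horb_toRecord_modelχq` / `hroots_toRecord_modelχq` — the Cor 3.5 (ii) junction inputs `horb` («`θ^{i₀}_env(𝕄_*)` is ONE
  `M^×_TM`-orbit») and `hroots` (print's root condition at the `∞`-level), for ANY constants `(A, c, O)` and ANY inversion
  family `iota` through the limit action of `ι`;
* **`splitting_toRecord_padic_of_eval_modelχq`** — [IUTchII] Prop 3.1 (i) «splittings up to torsion» over `ℚ̄_pˣ`
  (sub-DAG junction J3) — abc-iut-w4-d004's closer of record with the (R1) pointed-inversion PAIR := `(inversionAlpha C ι hι, ι^Θ)`,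
  (R2)(R3) `hsign`/`hroot`/`hfree` and `hker` ALL DISCHARGED;
with EVERY ι-datum binder a THEOREM at the model (`ι := inversionχq`; `γ` ⟸ abc-iut-L2-t8's `toLZ_surjective`; `ε` ⟸ abc-iut-w4-d010's
`exists_deck_element`; `hZι` = `IsInversionAut.toZ_apply` (abc-iut-L2-d1); `ι² = id` ⟸ `inversionχq_inversionχq`, `δ := 1`; `hβ` ⟸
`thetaIso_inversionχq_apply_eq_self`; `hαγ` ⟸ abc-iut-w5-d072's `toLZ_inversionAlpha_generator`), EVERY class-level [EtTh] Prop 1.4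
clause a THEOREM at the model (`h14sign` ⟸ `h14sign_of_prop15iii`; **`h14orbit` ⟸ this seat's `autMap_comap_etaDd_eq_self_modelχq`
(abc-iut-L2-d1's `transport_etaDdχq`) + abc-iut-w4-d010's `h14orbit_of_h14fix`** — GAP D-G-w4d010-2f in lift-tolerant form, model-
witnessed; `h14free` ⟸ `h14free_of_prop15_of_origin`), the guard `IsEtThOrigin` (F-2498) = abc-iut-L2-t5's `modelχq_isEtThOrigin`,
`hC`/`hS` = `compat_modelχq` / `modelχq_sec2Hyps`, and `hker` ⟸ `hfix_of_cyclotomeTower` at the tower.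
RESIDUAL BY NAME (all stated as binders): the record inputs (cyclotome family `mods`/`hmods` and tower `τc` — DATA; root cocycle
`f` — `rootLift`, abc-iut-w5-d233's `rootLift_mem_rootCocycles`; `h15` [EtTh] Prop 1.5 (iii) and `h15ii` Prop 1.5 (ii) for `E` —
THEOREMS at the Tate instance's section data (abc-iut-L2-t6 `prop15iii_etaleThetaDataOfClass_etaDdχq`, abc-iut-L2-t8
`prop13_prop15_sectionData_modelTate`); cusp labels `L`; `hZ` — abc-iut's `ModelCyclotomes.nonempty_lDeltaQuot_rigidData_mulEquiv_zHat`
under `IsEtThOrigin`/`hYcl`; `hlim` — abc-iut-w4-d030's `bijective_rigidLimHom`; `hι` — abc-iut-L2-d1's `map_Huuχq_inversionχq` at the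
`X̲̲` of record), **(H1) `PiYddCharacteristic C` (F-2633 at the instance; ROUTE A: ⟸ F-0620 `Cor218_i` at the instance,
abc-iut-L6-d6's row «COR218I-AT-MODELTATE»)**, and the Cor 3.5 (K)/(E) DATA (constants `c`/`c₀` bijective with `μ ⊆ O`, one evaluation
section `s₀` with `hact` and finite-index image, the evaluation `R₀ θ = κ₀ q` with `q` a non-unit, the inversion family `iota`, a base
point `θ ∈ θ^{i₀}_env`) — NO ι-datum binder, NO class-level binder, NO `hker`, NO §1-fact binder other than `h15`/`h15ii` (themselves
theorems at the Tate record). Technical note: at the concrete model the generic instances `ThetaSetting.lDeltaTheta_normal`,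
`EtaleThetaDataOfSetting.instIsMulCommutative_lDeltaTheta`, `EtaleThetaDataOfSetting.unitsAction` are not found by instance
search (discrimination-tree keys of the unfolded model carrier); they are supplied BY NAME with `haveI`/`letI` in the statements.

HONEST LABEL. `modelχq` / `modelTate` is a SEMI-SYNTHETIC model of the typed [EtTh] §1 interface (`K = ℚ_p`, `q_X = p²`,
`Π^tp_X = (F̂₂ ×_Ẑ ℤ) ⋊ G_{ℚ_p}`; not the tempered `π₁` of a curve, no theta FUNCTION): binder-discharge / joint-satisfiability
evidence for the typed interface and the kernel record that, at the stage-2 inhabitant, the ι-datum, the class-level clauses and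
`hker` of the Cor 3.5 (ii) / Prop 3.1 (i) closers are not assumptions. The [IUTchII] claim key `Mochizuki2012` is DISPUTED (D-0012)
and nothing of it is asserted; nothing of [EtTh] is asserted; no side is taken on [IUTchIII] Cor. 3.12 nor on which lift of the
inversion print's `ι` denotes; typed ≠ proved; instantiated ≠ endorsed; nothing here bears on whether abc is proved or refuted.
bears_on: LADDER-ABC:A2.L-K (K-L6, IUTchII:Prop3.1(i) / Cor3.5(ii), GAP D-G-w4d010-2f instance form) → rung 0 `Summit.ABC`.
-/

noncomputable section

open Literature.AnabelianGeometry.EtaleTheta (ContH1 ThetaSetting)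
open Literature.AnabelianGeometry.EtaleTheta
open _root_.Topology

namespace Literature.IUT.HodgeArakelov

namespace EtaleLevels

open CohomologySystemOfContH1 EtaleThetaDataOfSetting TemperedThetaMonoids BadPrimeGaussianMonoids
open Literature.AnabelianGeometry.EtaleTheta.SettingModel
open Literature.AnabelianGeometry.SemiGraphs

/-! ## §A. The stage-2 model `modelχq p i j`: the ι-datum and the class-level clauses of the Cor 3.5 (ii) / Prop 3.1 (i)
junction inputs are THEOREMS (record inputs kept general) -/

section StageTwo

variable (p : ℕ) [Fact p.Prime] (i j : ℤ) (hj : Even j)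
  (E : (ThetaSetting.modelχq p i j hj).EtaleThetaData)
  {l : ℕ} (C : E.DoubleUnderline l)
  (hι : C.Huu.map (inversionχq p i j).toMulEquiv.toMonoidHom = C.Huu)
  (hl : l.Prime) (hp2 : p ≠ 2) (hpl : p ≠ l) (hζ : ∃ ζ : (ThetaSetting.modelχq p i j hj).K, IsPrimitiveRoot ζ (4 * l))
  (mods : ∀ M : ℕ+, (ThetaSetting.modelχq p i j hj).CyclotomeMod l M)
  (f : contCocycles (ThetaSetting.modelχq p i j hj).toTheta (ThetaSetting.modelχq p i j hj).DeltaTheta C.GtpYdduu)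
  (hf : f ∈ C.rootCocycles (compat_modelχq p i j hj))
  (hmods : ∀ (M M' : ℕ+) (h : (M : ℕ) ∣ (M' : ℕ)) (x : (ThetaSetting.modelχq p i j hj).lDeltaTheta l),
    MuN.red p M M' h ((mods M').red x) = (mods M).red x)
  (h15 : ThetaSetting.Prop15iii E (compat_modelχq p i j hj))
  (L : C.CuspLabels)
  (hZ : ∀ M : ℕ+, Nonempty (ModelCyclotomes.lDeltaQuot (C.rigidData (mods M) (compat_modelχq p i j hj)
    (ThetaSetting.modelχq_sec2Hyps p i j hj) h15 L) ≃* Literature.IUT.HodgeTheaters.ZHat))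
  (hcharY : EtaleThetaDataOfSetting.PiYddCharacteristic C)
  (hlim : Function.Bijective (rigidLimHom C (compat_modelχq p i j hj) (ThetaSetting.modelχq_sec2Hyps p i j hj) hl hp2 hpl
    hζ mods f hf hmods h15 L hZ))

/-- **`horbit` AT THE `θ_env` DATA OF THE STAGE-2 MODEL** ([IUTchII] Prop 2.2 (ii) p. 66 / Prop 3.1 (i) p. 87): for the
inversion `ι := inversionχq` of `modelχq p i j` (abc-iut-w5-d249 / L2-d1) and its CONSTRUCTED theta companion
`thetaCompanionOfAut` (abc-iut-w5-d072), any two elements of `θ^ι(Π_v)` in the limit, at the genuine `θ_env` data over ANY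
record inputs, differ by a torsion class — abc-iut-w4-d010's `horbit_thetaEnvData_inversion_of_classLevel_orbit` (p457998)
with EVERY ι-datum binder (`γ`, `ε`, `hZι`, `δ := 1`, `hβ`) and EVERY class-level binder (`h14sign`, `h14orbit`, `h14free`)
and the guard `IsEtThOrigin` THEOREMS of the tree at the model (`toLZ_surjective`, `exists_deck_element`,
`IsInversionAut.toZ_apply`, `inversionχq_inversionχq`, `thetaIso_inversionχq_apply_eq_self`, `h14sign_of_prop15iii`,
`autMap_comap_etaDd_eq_self_modelχq` + `h14orbit_of_h14fix`, `h14free_of_prop15_of_origin`, `modelχq_isEtThOrigin`).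
Residual: the record inputs, (H1), [EtTh] Prop. 1.5 (iii)/(ii) for `E`, the cyclotome tower.
[claim: Mochizuki2012, status: disputed] (IUTchII §3 Prop 3.1 (i), kurims p.87) -/
theorem horbit_thetaEnvData_modelχq (hE : E.etaDd = etaDdχq p i j hj)
    (h15ii : ThetaSetting.Prop15ii E.toKummerData (compat_modelχq p i j hj))
    {Es : Set ℕ+} (τc : (ThetaSetting.modelχq p i j hj).CyclotomeTower l Es) :
    let cι : ThetaSetting.ThetaCompanion (Dα := ThetaSetting.modelχq p i j hj) (Dβ := ThetaSetting.modelχq p i j hj)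
        (inversionχq p i j) :=
      (ThetaSetting.modelχq p i j hj).thetaCompanionOfAut (inversionχq p i j)
        (isInversionAut_inversionχq p i j hj).map_deltaTemp (hasThetaTopology_modelχq p i j hj).isQuotientMap_toTheta
    haveI := piYdd_normal C (compat_modelχq p i j hj)
    ∀ x ∈ (thetaEnvData C (compat_modelχq p i j hj) (ThetaSetting.modelχq_sec2Hyps p i j hj) hl hp2 hpl hζ mods f hf hmods
          h15 L hZ hcharY hlim).thetaIotaLim
        (pairRhoLim C (inversionAlpha C (inversionχq p i j) hι) cι.thetaIso (thetaCompanion_phi C (inversionχq p i j) hι cι)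
          (mem_lDeltaTheta_iff_thetaCompanion (D := ThetaSetting.modelχq p i j hj) (inversionχq p i j) cι l)
          (mem_PiYdd_iff_of_piYddCharacteristic C hcharY _)),
      ∀ x' ∈ (thetaEnvData C (compat_modelχq p i j hj) (ThetaSetting.modelχq_sec2Hyps p i j hj) hl hp2 hpl hζ mods f hf hmods
          h15 L hZ hcharY hlim).thetaIotaLim
        (pairRhoLim C (inversionAlpha C (inversionχq p i j) hι) cι.thetaIso (thetaCompanion_phi C (inversionχq p i j) hι cι)
          (mem_lDeltaTheta_iff_thetaCompanion (D := ThetaSetting.modelχq p i j hj) (inversionχq p i j) cι l)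
          (mem_PiYdd_iff_of_piYddCharacteristic C hcharY _)),
        IsOfFinAddOrder (x' - x) := by
  intro cι
  haveI := piYdd_normal C (compat_modelχq p i j hj)
  haveI := (compat_modelχq p i j hj).GtpYdd_normal
  obtain ⟨γ, hγ⟩ := C.toLZ_surjective (Multiplicative.ofAdd 1)
  obtain ⟨ε, hε₁, hε₂⟩ := exists_deck_element C (ThetaSetting.modelχq_sec2Hyps p i j hj)
  exact horbit_thetaEnvData_inversion_of_classLevel_orbit C (compat_modelχq p i j hj) (ThetaSetting.modelχq_sec2Hyps p i j hj) hl
    hp2 hpl hζ mods f hf hmods h15 L hZ hcharY hlim (ThetaSetting.modelχq_isEtThOrigin p i j hj) τc (inversionχq p i j) hι cι γ ε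
    hγ hε₁ hε₂ ((isInversionAut_inversionχq p i j hj).toZ_apply _) 1
    (fun x => by
      rw [OneMemClass.coe_one, one_mul, inv_one, mul_one]
      exact inversionχq_inversionχq p i j _)
    (fun a ha => by
      rw [thetaIso_inversionχq_apply_eq_self p i j hj cι ha, mul_inv_cancel]
      exact Subgroup.one_mem _)
    (h14sign_of_prop15iii C (compat_modelχq p i j hj) (ThetaSetting.modelχq_sec2Hyps p i j hj) h15 ε hε₁)
    (h14free_of_prop15_of_origin C (compat_modelχq p i j hj) (ThetaSetting.modelχq_isEtThOrigin p i j hj) h15 h15ii γ hγ)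
    (h14orbit_of_h14fix C (inversionχq p i j) hι cι hcharY
      (autMap_comap_etaDd_eq_self_modelχq p i j hj E hE C hι cι (mem_PiYdd_iff_of_piYddCharacteristic C hcharY _)))

/-- **The Cor 3.5 (ii) junction input `horb` AT THE `θ_env` RECORD OF THE STAGE-2 MODEL** ([IUTchII] Cor 2.8 (i) p. 82 /
Prop 3.1 (i) p. 87): `θ^{i₀}_env(𝕄_*)` is ONE `M^×_TM`-orbit, for ANY constants `(A, c, O)` and ANY inversion family `iota`
whose `i₀`-th member is the limit action of `ι := inversionχq` with its constructed companion — abc-iut-w4-d010's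
`horb_toRecord_inversion_of_classLevel_orbit` (p457998) with every ι-datum / class-level / guard binder a THEOREM at the
model (as in `horbit_thetaEnvData_modelχq`). Residual: record inputs, (H1), Prop. 1.5 (iii)/(ii) for `E`, the tower, the
constants with `c` bijective and `μ ⊆ O`. [claim: Mochizuki2012, status: disputed] (IUTchII §3 Prop 3.1 (i), kurims p.87) -/
theorem horb_toRecord_modelχq (hE : E.etaDd = etaDdχq p i j hj)
    (h15ii : ThetaSetting.Prop15ii E.toKummerData (compat_modelχq p i j hj))
    {Es : Set ℕ+} (τc : (ThetaSetting.modelχq p i j hj).CyclotomeTower l Es) :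
    let cι : ThetaSetting.ThetaCompanion (Dα := ThetaSetting.modelχq p i j hj) (Dβ := ThetaSetting.modelχq p i j hj)
        (inversionχq p i j) :=
      (ThetaSetting.modelχq p i j hj).thetaCompanionOfAut (inversionχq p i j)
        (isInversionAut_inversionχq p i j hj).map_deltaTemp (hasThetaTopology_modelχq p i j hj).isQuotientMap_toTheta
    let R := thetaEnvData C (compat_modelχq p i j hj) (ThetaSetting.modelχq_sec2Hyps p i j hj) hl hp2 hpl hζ mods f hf hmods
      h15 L hZ hcharY hlim
    haveI := piYdd_normal C (compat_modelχq p i j hj)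
    haveI : ((ThetaSetting.modelχq p i j hj).lDeltaTheta l).Normal := ThetaSetting.lDeltaTheta_normal _ l
    haveI : IsMulCommutative ((ThetaSetting.modelχq p i j hj).lDeltaTheta l) :=
      EtaleThetaDataOfSetting.instIsMulCommutative_lDeltaTheta (D := ThetaSetting.modelχq p i j hj) l
    ∀ {Iota : Type} (iota : Iota → R.D.coh.lim ≃+ R.D.coh.lim)
      {A : Type} [CommGroup A] [MulDistribMulAction (Pi C) A] [TopologicalSpace A] [RootableBy A ℕ]
      (c : CyclotomeCoefficients (phi C) ((ThetaSetting.modelχq p i j hj).lDeltaTheta l) A)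
      (hA : ∀ b : A, IsOpen (MulAction.stabilizer (Pi C) b : Set (Pi C)))
      (hfi : ∀ b : A, (MulAction.stabilizer (Pi C) b).FiniteIndex) (O : Submonoid A)
      (_hc : Function.Bijective c.hom) (_hOtors : ∀ a : A, IsOfFinOrder a → a ∈ O ∧ a⁻¹ ∈ O) {i₀ : Iota}
      (_hi₀ : iota i₀ = pairRhoLim C (inversionAlpha C (inversionχq p i j) hι) cι.thetaIso
        (thetaCompanion_phi C (inversionχq p i j) hι cι)
        (mem_lDeltaTheta_iff_thetaCompanion (D := ThetaSetting.modelχq p i j hj) (inversionχq p i j) cι l)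
        (mem_PiYdd_iff_of_piYddCharacteristic C hcharY _))
      {θ : (R.toRecord (h1LimConjMulAut (phi C) ((ThetaSetting.modelχq p i j hj).lDeltaTheta l) (PiYdd C))
        (h1LimKummerOn (phi C) ((ThetaSetting.modelχq p i j hj).lDeltaTheta l) (PiYdd C) c hA hfi O) iota).H}
      (_hθ : θ ∈ (R.toRecord (h1LimConjMulAut (phi C) ((ThetaSetting.modelχq p i j hj).lDeltaTheta l) (PiYdd C))
        (h1LimKummerOn (phi C) ((ThetaSetting.modelχq p i j hj).lDeltaTheta l) (PiYdd C) c hA hfi O) iota).thetaEnv i₀),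
      ∀ θ' ∈ (R.toRecord (h1LimConjMulAut (phi C) ((ThetaSetting.modelχq p i j hj).lDeltaTheta l) (PiYdd C))
          (h1LimKummerOn (phi C) ((ThetaSetting.modelχq p i j hj).lDeltaTheta l) (PiYdd C) c hA hfi O) iota).thetaEnv i₀,
        ∃ u ∈ (R.toRecord (h1LimConjMulAut (phi C) ((ThetaSetting.modelχq p i j hj).lDeltaTheta l) (PiYdd C))
          (h1LimKummerOn (phi C) ((ThetaSetting.modelχq p i j hj).lDeltaTheta l) (PiYdd C) c hA hfi O) iota).units,
          θ' = u * θ := by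
  intro cι R Iota iota A _ _ _ _ c hA hfi O hc hOtors i₀ hi₀ θ hθ
  haveI := piYdd_normal C (compat_modelχq p i j hj)
  haveI := (compat_modelχq p i j hj).GtpYdd_normal
  obtain ⟨γ, hγ⟩ := C.toLZ_surjective (Multiplicative.ofAdd 1)
  obtain ⟨ε, hε₁, hε₂⟩ := exists_deck_element C (ThetaSetting.modelχq_sec2Hyps p i j hj)
  exact horb_toRecord_inversion_of_classLevel_orbit C (compat_modelχq p i j hj) (ThetaSetting.modelχq_sec2Hyps p i j hj) hl
    hp2 hpl hζ mods f hf hmods h15 L hZ hcharY hlim (ThetaSetting.modelχq_isEtThOrigin p i j hj) τc (inversionχq p i j) hι cι γ ε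
    hγ hε₁ hε₂ ((isInversionAut_inversionχq p i j hj).toZ_apply _) 1
    (fun x => by
      rw [OneMemClass.coe_one, one_mul, inv_one, mul_one]
      exact inversionχq_inversionχq p i j _)
    (fun a ha => by
      rw [thetaIso_inversionχq_apply_eq_self p i j hj cι ha, mul_inv_cancel]
      exact Subgroup.one_mem _)
    (h14sign_of_prop15iii C (compat_modelχq p i j hj) (ThetaSetting.modelχq_sec2Hyps p i j hj) h15 ε hε₁)
    (h14free_of_prop15_of_origin C (compat_modelχq p i j hj) (ThetaSetting.modelχq_isEtThOrigin p i j hj) h15 h15ii γ hγ)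
    iota c hA hfi O hc hOtors hi₀ hθ
    (h14orbit_of_h14fix C (inversionχq p i j) hι cι hcharY
      (autMap_comap_etaDd_eq_self_modelχq p i j hj E hE C hι cι (mem_PiYdd_iff_of_piYddCharacteristic C hcharY _)))

/-- **Print's root condition `hroots` AT THE `θ_env` RECORD OF THE STAGE-2 MODEL** ([IUTchII] Prop 1.4 p. 27 / Cor 3.5 (ii)
p. 95, `∞`-level): every `ϑ ∈ ∞θ^{i₀}_env(𝕄_*)` has a positive power in `M^×_TM · θ^ℕ`, for ANY constants and ANY inversion
family through the limit action of `ι := inversionχq` — abc-iut-w4-d010's `hroots_toRecord_inversion_of_classLevel_orbit` (p457998)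
with every ι-datum / class-level / guard binder a THEOREM at the model. Residual as in `horb_toRecord_modelχq`.
[claim: Mochizuki2012, status: disputed] (IUTchII §3 Cor 3.5 (ii), kurims p.95) -/
theorem hroots_toRecord_modelχq (hE : E.etaDd = etaDdχq p i j hj)
    (h15ii : ThetaSetting.Prop15ii E.toKummerData (compat_modelχq p i j hj))
    {Es : Set ℕ+} (τc : (ThetaSetting.modelχq p i j hj).CyclotomeTower l Es) :
    let cι : ThetaSetting.ThetaCompanion (Dα := ThetaSetting.modelχq p i j hj) (Dβ := ThetaSetting.modelχq p i j hj)
        (inversionχq p i j) :=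
      (ThetaSetting.modelχq p i j hj).thetaCompanionOfAut (inversionχq p i j)
        (isInversionAut_inversionχq p i j hj).map_deltaTemp (hasThetaTopology_modelχq p i j hj).isQuotientMap_toTheta
    let R := thetaEnvData C (compat_modelχq p i j hj) (ThetaSetting.modelχq_sec2Hyps p i j hj) hl hp2 hpl hζ mods f hf hmods
      h15 L hZ hcharY hlim
    haveI := piYdd_normal C (compat_modelχq p i j hj)
    haveI : ((ThetaSetting.modelχq p i j hj).lDeltaTheta l).Normal := ThetaSetting.lDeltaTheta_normal _ l
    haveI : IsMulCommutative ((ThetaSetting.modelχq p i j hj).lDeltaTheta l) :=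
      EtaleThetaDataOfSetting.instIsMulCommutative_lDeltaTheta (D := ThetaSetting.modelχq p i j hj) l
    ∀ {Iota : Type} (iota : Iota → R.D.coh.lim ≃+ R.D.coh.lim)
      {A : Type} [CommGroup A] [MulDistribMulAction (Pi C) A] [TopologicalSpace A] [RootableBy A ℕ]
      (c : CyclotomeCoefficients (phi C) ((ThetaSetting.modelχq p i j hj).lDeltaTheta l) A)
      (hA : ∀ b : A, IsOpen (MulAction.stabilizer (Pi C) b : Set (Pi C)))
      (hfi : ∀ b : A, (MulAction.stabilizer (Pi C) b).FiniteIndex) (O : Submonoid A)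
      (_hc : Function.Bijective c.hom) (_hOtors : ∀ a : A, IsOfFinOrder a → a ∈ O ∧ a⁻¹ ∈ O) {i₀ : Iota}
      (_hi₀ : iota i₀ = pairRhoLim C (inversionAlpha C (inversionχq p i j) hι) cι.thetaIso
        (thetaCompanion_phi C (inversionχq p i j) hι cι)
        (mem_lDeltaTheta_iff_thetaCompanion (D := ThetaSetting.modelχq p i j hj) (inversionχq p i j) cι l)
        (mem_PiYdd_iff_of_piYddCharacteristic C hcharY _))
      {θ : (R.toRecord (h1LimConjMulAut (phi C) ((ThetaSetting.modelχq p i j hj).lDeltaTheta l) (PiYdd C))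
        (h1LimKummerOn (phi C) ((ThetaSetting.modelχq p i j hj).lDeltaTheta l) (PiYdd C) c hA hfi O) iota).H}
      (_hθ : θ ∈ (R.toRecord (h1LimConjMulAut (phi C) ((ThetaSetting.modelχq p i j hj).lDeltaTheta l) (PiYdd C))
        (h1LimKummerOn (phi C) ((ThetaSetting.modelχq p i j hj).lDeltaTheta l) (PiYdd C) c hA hfi O) iota).thetaEnv i₀),
      ∀ ϑ ∈ (R.toRecord (h1LimConjMulAut (phi C) ((ThetaSetting.modelχq p i j hj).lDeltaTheta l) (PiYdd C))
          (h1LimKummerOn (phi C) ((ThetaSetting.modelχq p i j hj).lDeltaTheta l) (PiYdd C) c hA hfi O) iota).inftyThetaEnv i₀,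
        ∃ N : ℕ, 0 < N ∧ ϑ ^ N ∈ splitMonoid
          (R.toRecord (h1LimConjMulAut (phi C) ((ThetaSetting.modelχq p i j hj).lDeltaTheta l) (PiYdd C))
            (h1LimKummerOn (phi C) ((ThetaSetting.modelχq p i j hj).lDeltaTheta l) (PiYdd C) c hA hfi O) iota).units
          (Submonoid.powers θ) := by
  intro cι R Iota iota A _ _ _ _ c hA hfi O hc hOtors i₀ hi₀ θ hθ
  haveI := piYdd_normal C (compat_modelχq p i j hj)
  haveI := (compat_modelχq p i j hj).GtpYdd_normal
  obtain ⟨γ, hγ⟩ := C.toLZ_surjective (Multiplicative.ofAdd 1)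
  obtain ⟨ε, hε₁, hε₂⟩ := exists_deck_element C (ThetaSetting.modelχq_sec2Hyps p i j hj)
  exact hroots_toRecord_inversion_of_classLevel_orbit C (compat_modelχq p i j hj) (ThetaSetting.modelχq_sec2Hyps p i j hj) hl
    hp2 hpl hζ mods f hf hmods h15 L hZ hcharY hlim (ThetaSetting.modelχq_isEtThOrigin p i j hj) τc (inversionχq p i j) hι cι γ ε
    hγ hε₁ hε₂ ((isInversionAut_inversionχq p i j hj).toZ_apply _) 1
    (fun x => by
      rw [OneMemClass.coe_one, one_mul, inv_one, mul_one]
      exact inversionχq_inversionχq p i j _)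
    (fun a ha => by
      rw [thetaIso_inversionχq_apply_eq_self p i j hj cι ha, mul_inv_cancel]
      exact Subgroup.one_mem _)
    (h14sign_of_prop15iii C (compat_modelχq p i j hj) (ThetaSetting.modelχq_sec2Hyps p i j hj) h15 ε hε₁)
    (h14free_of_prop15_of_origin C (compat_modelχq p i j hj) (ThetaSetting.modelχq_isEtThOrigin p i j hj) h15 h15ii γ hγ)
    iota c hA hfi O hc hOtors hi₀ hθ
    (h14orbit_of_h14fix C (inversionχq p i j) hι cι hcharY
      (autMap_comap_etaDd_eq_self_modelχq p i j hj E hE C hι cι (mem_PiYdd_iff_of_piYddCharacteristic C hcharY _)))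

/-- **[IUTchII] Prop 3.1 (i) «splittings up to torsion» AT THE `θ_env` RECORD OF THE STAGE-2 MODEL over `ℚ̄_pˣ`**
(sub-DAG junction J3; p. 87): abc-iut-w4-d004's closer of record `splitting_toRecord_padic_of_eval_pairRhoLim` (p441594) with
the (R1) pointed-inversion PAIR := `(inversionAlpha C ι hι, ι^Θ)` for `ι := inversionχq` and its constructed companion, the
`ℤ`-reversal, the deck element, the `toLZ`-generator, (R2)(R3) `hsign`/`hroot`/`hfree` (⟸ abc-iut-w4-d010's
`rootLevel_inputs_of_classLevel_orbit` fed with the class-level clauses, all theorems at the model as above) and `hker` (⟸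
`IsEtThOrigin` + the tower, abc-iut-w4-d041's `hfix_of_cyclotomeTower`) ALL DISCHARGED. Residual: record inputs, (H1),
Prop. 1.5 (iii)/(ii) for `E`, the tower, and the Cor 3.5 (K)/(E) DATA — constants `c`/`c₀` bijective with `μ ⊆ O`, ONE
evaluation section `s₀` with `hact` and finite-index image, the evaluation `R₀ θ = κ₀ q` with `q` a non-unit.
SEMI-SYNTHETIC MODEL, binder-discharge evidence only. [claim: Mochizuki2012, status: disputed] (IUTchII §3 Prop 3.1 (i), kurims p.87) -/
theorem splitting_toRecord_padic_of_eval_modelχq (hE : E.etaDd = etaDdχq p i j hj)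
    (h15ii : ThetaSetting.Prop15ii E.toKummerData (compat_modelχq p i j hj))
    {Es : Set ℕ+} (τc : (ThetaSetting.modelχq p i j hj).CyclotomeTower l Es) :
    let cι : ThetaSetting.ThetaCompanion (Dα := ThetaSetting.modelχq p i j hj) (Dβ := ThetaSetting.modelχq p i j hj)
        (inversionχq p i j) :=
      (ThetaSetting.modelχq p i j hj).thetaCompanionOfAut (inversionχq p i j)
        (isInversionAut_inversionχq p i j hj).map_deltaTemp (hasThetaTopology_modelχq p i j hj).isQuotientMap_toTheta
    let R := thetaEnvData C (compat_modelχq p i j hj) (ThetaSetting.modelχq_sec2Hyps p i j hj) hl hp2 hpl hζ mods f hf hmods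
      h15 L hZ hcharY hlim
    haveI := piYdd_normal C (compat_modelχq p i j hj)
    haveI : ((ThetaSetting.modelχq p i j hj).lDeltaTheta l).Normal := ThetaSetting.lDeltaTheta_normal _ l
    haveI : IsMulCommutative ((ThetaSetting.modelχq p i j hj).lDeltaTheta l) :=
      EtaleThetaDataOfSetting.instIsMulCommutative_lDeltaTheta (D := ThetaSetting.modelχq p i j hj) l
    letI : MulDistribMulAction (Pi C) (PadicAlgCl p)ˣ := EtaleThetaDataOfSetting.unitsAction C
    ∀ {Iota : Type} (iota : Iota → R.D.coh.lim ≃+ R.D.coh.lim)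
      {P₀ : TopGroup.{0}} (φ₀ : P₀ →* (ThetaSetting.modelχq p i j hj).GtpTheta) (s₀ : P₀ →* Pi C)
      (hs₀ : Continuous ((MonoidHom.id (Pi C)).comp s₀))
      (hN : (⊤ : Subgroup P₀).map ((MonoidHom.id (Pi C)).comp s₀) ≤ PiYdd C)
      (hφ : (phi C).comp ((MonoidHom.id (Pi C)).comp s₀) = φ₀)
      [TopologicalSpace (PadicAlgCl p)ˣ]
      (c : CyclotomeCoefficients (phi C) ((ThetaSetting.modelχq p i j hj).lDeltaTheta l) (PadicAlgCl p)ˣ)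
      (hA : ∀ b : (PadicAlgCl p)ˣ, IsOpen (MulAction.stabilizer (Pi C) b : Set (Pi C)))
      (hfi : ∀ b : (PadicAlgCl p)ˣ, (MulAction.stabilizer (Pi C) b).FiniteIndex) (O : Submonoid (PadicAlgCl p)ˣ)
      [MulDistribMulAction P₀ (PadicAlgCl p)ˣ]
      (c₀ : CyclotomeCoefficients φ₀ ((ThetaSetting.modelχq p i j hj).lDeltaTheta l) (PadicAlgCl p)ˣ)
      (hA₀ : ∀ b : (PadicAlgCl p)ˣ, IsOpen (MulAction.stabilizer P₀ b : Set P₀))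
      (hfi₀ : ∀ b : (PadicAlgCl p)ˣ, (MulAction.stabilizer P₀ b).FiniteIndex)
      (_hc : Function.Bijective c.hom) (_hOtors : ∀ a : (PadicAlgCl p)ˣ, IsOfFinOrder a → a ∈ O ∧ a⁻¹ ∈ O)
      (_hc₀ : Function.Bijective c₀.hom) (_hc₀c : ∀ ζ, c₀.hom ζ = c.hom ζ)
      (_hact : ∀ (g : P₀) (a : (PadicAlgCl p)ˣ), g • a = s₀ g • a)
      [((EtaleThetaDataOfSetting.aug C).comp s₀).range.FiniteIndex] {i₀ : Iota}
      (_hi₀ : iota i₀ = pairRhoLim C (inversionAlpha C (inversionχq p i j) hι) cι.thetaIso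
        (thetaCompanion_phi C (inversionχq p i j) hι cι)
        (mem_lDeltaTheta_iff_thetaCompanion (D := ThetaSetting.modelχq p i j hj) (inversionχq p i j) cι l)
        (mem_PiYdd_iff_of_piYddCharacteristic C hcharY _))
      {θ : (R.toRecord (h1LimConjMulAut (phi C) ((ThetaSetting.modelχq p i j hj).lDeltaTheta l) (PiYdd C))
        (h1LimKummerOn (phi C) ((ThetaSetting.modelχq p i j hj).lDeltaTheta l) (PiYdd C) c hA hfi O) iota).H}
      (_hθ : θ ∈ (R.toRecord (h1LimConjMulAut (phi C) ((ThetaSetting.modelχq p i j hj).lDeltaTheta l) (PiYdd C))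
        (h1LimKummerOn (phi C) ((ThetaSetting.modelχq p i j hj).lDeltaTheta l) (PiYdd C) c hA hfi O) iota).thetaEnv i₀)
      (R₀ : (R.toRecord (h1LimConjMulAut (phi C) ((ThetaSetting.modelχq p i j hj).lDeltaTheta l) (PiYdd C))
          (h1LimKummerOn (phi C) ((ThetaSetting.modelχq p i j hj).lDeltaTheta l) (PiYdd C) c hA hfi O) iota).H →*
        Multiplicative (h1Lim φ₀ ((ThetaSetting.modelχq p i j hj).lDeltaTheta l) (⊤ : Subgroup P₀) ⊥))
      (_hR₀ : ∀ y, Multiplicative.toAdd (R₀ y) =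
        h1LimCongr ((ThetaSetting.modelχq p i j hj).lDeltaTheta l) ⊤ hφ ⊥
          (h1LimComap (phi C) ((ThetaSetting.modelχq p i j hj).lDeltaTheta l) ((MonoidHom.id (Pi C)).comp s₀) hs₀ hN
            (AddEquiv.additiveMultiplicative (h1Lim (phi C) ((ThetaSetting.modelχq p i j hj).lDeltaTheta l) (PiYdd C) ⊥)
              (Additive.ofMul y))))
      (q : O) (_hRθ : R₀ θ = h1LimKummerOn φ₀ ((ThetaSetting.modelχq p i j hj).lDeltaTheta l) ⊤ c₀ hA₀ hfi₀ O q)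
      (_hq : ¬ IsUnit q),
      IsSplittingUpToTorsion
          (R.toRecord (h1LimConjMulAut (phi C) ((ThetaSetting.modelχq p i j hj).lDeltaTheta l) (PiYdd C))
            (h1LimKummerOn (phi C) ((ThetaSetting.modelχq p i j hj).lDeltaTheta l) (PiYdd C) c hA hfi O) iota).units
          (Submonoid.closure ((R.toRecord (h1LimConjMulAut (phi C) ((ThetaSetting.modelχq p i j hj).lDeltaTheta l) (PiYdd C))
            (h1LimKummerOn (phi C) ((ThetaSetting.modelχq p i j hj).lDeltaTheta l) (PiYdd C) c hA hfi O) iota).inftyThetaEnv i₀)) ∧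
        IsSplittingUpToTorsion
          (R.toRecord (h1LimConjMulAut (phi C) ((ThetaSetting.modelχq p i j hj).lDeltaTheta l) (PiYdd C))
            (h1LimKummerOn (phi C) ((ThetaSetting.modelχq p i j hj).lDeltaTheta l) (PiYdd C) c hA hfi O) iota).units
          (Submonoid.closure ((R.toRecord (h1LimConjMulAut (phi C) ((ThetaSetting.modelχq p i j hj).lDeltaTheta l) (PiYdd C))
            (h1LimKummerOn (phi C) ((ThetaSetting.modelχq p i j hj).lDeltaTheta l) (PiYdd C) c hA hfi O) iota).thetaEnv i₀)) := by
  intro cι R Iota iota P₀ φ₀ s₀ hs₀ hN hφ _ c hA hfi O _ c₀ hA₀ hfi₀ hc hOtors hc₀ hc₀c hact _ i₀ hi₀ θ hθ R₀ hR₀ q hRθ hq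
  haveI := piYdd_normal C (compat_modelχq p i j hj)
  haveI := (compat_modelχq p i j hj).GtpYdd_normal
  obtain ⟨γ, hγ⟩ := C.toLZ_surjective (Multiplicative.ofAdd 1)
  obtain ⟨ε, hε₁, hε₂⟩ := exists_deck_element C (ThetaSetting.modelχq_sec2Hyps p i j hj)
  have hZι : (ThetaSetting.modelχq p i j hj).toZ (inversionχq p i j (γ : (ThetaSetting.modelχq p i j hj).PiTemp)) =
      ((ThetaSetting.modelχq p i j hj).toZ (γ : (ThetaSetting.modelχq p i j hj).PiTemp))⁻¹ :=
    (isInversionAut_inversionχq p i j hj).toZ_apply _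
  obtain ⟨hsign, hroot, hfree⟩ := rootLevel_inputs_of_classLevel_orbit C (inversionχq p i j) hι cι
    (ThetaSetting.modelχq_sec2Hyps p i j hj) hcharY γ ε hγ hε₁ hε₂ 1
    (fun x => by
      rw [OneMemClass.coe_one, one_mul, inv_one, mul_one]
      exact inversionχq_inversionχq p i j _)
    (fun a ha => by
      rw [thetaIso_inversionχq_apply_eq_self p i j hj cι ha, mul_inv_cancel]
      exact Subgroup.one_mem _)
    (h14sign_of_prop15iii C (compat_modelχq p i j hj) (ThetaSetting.modelχq_sec2Hyps p i j hj) h15 ε hε₁)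
    (h14orbit_of_h14fix C (inversionχq p i j) hι cι hcharY
      (autMap_comap_etaDd_eq_self_modelχq p i j hj E hE C hι cι (mem_PiYdd_iff_of_piYddCharacteristic C hcharY _)))
    (h14free_of_prop15_of_origin C (compat_modelχq p i j hj) (ThetaSetting.modelχq_isEtThOrigin p i j hj) h15 h15ii γ hγ)
  exact splitting_toRecord_padic_of_eval_pairRhoLim C (compat_modelχq p i j hj) (ThetaSetting.modelχq_sec2Hyps p i j hj) hl hp2
    hpl hζ mods f hf hmods h15 L hZ hcharY hlim iota φ₀ s₀ hs₀ hN hφ c hA hfi O c₀ hA₀ hfi₀ hc hOtors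
    (inversionAlpha C (inversionχq p i j) hι) cι.thetaIso (thetaCompanion_phi C (inversionχq p i j) hι cι)
    (mem_lDeltaTheta_iff_thetaCompanion (D := ThetaSetting.modelχq p i j hj) (inversionχq p i j) cι l)
    (mem_PiYdd_iff_of_piYddCharacteristic C hcharY _) γ ε hγ hε₁ hε₂
    (toLZ_inversionAlpha_generator C (inversionχq p i j) hι γ hγ hZι) hsign hroot hfree
    (hker_coh_of_fixed C (hfix_of_cyclotomeTower C (ThetaSetting.modelχq_isEtThOrigin p i j hj) τc))
    hc₀ hc₀c hact hi₀ hθ R₀ hR₀ q hRθ hq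

end StageTwo

end EtaleLevels

end Literature.IUT.HodgeArakelov

end
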